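import Literature.Probability.LatticeModels.GaussianDominationProofs
import Mathlib.Analysis.Matrix.Order
import Mathlib.Analysis.CStarAlgebra.Matrix
import HarnessLib

/-!
# Gaussian domination for reflection-positive PAIR interactions on the even torus
# (Fröhlich–Israel–Lieb–Simon 1978; Friedli–Velenik 2017, Prop. 10.27 beyond nearest neighbours)

Topic `Probability/LatticeModels`, namespace `Literature.Probability.LatticeModels`. Companion of
`GaussianDomination.lean` / `GaussianDominationProofs.lean`, which prove Friedli–Velenik's Prop. 10.27
(`Z(h) ≤ Z(0)`) for Ising spins with NEAREST-NEIGHBOUR couplings on the torus `(ℤ/Lℤ)^d`. Here the same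
descent is run for an arbitrary symmetric pair interaction `J : V → V → ℝ` on the torus that is
reflection positive through the bond-bisecting coordinate mirrors — the setting of Panis 2023
(arXiv:2309.05797), §3.1, Definition 3.1 and examples (ii)–(iii) (Yukawa and power-law couplings
`J_{x,y} = C|x-y|₁^{-d-α}`), whose Proposition 3.4 (the torus infrared bound for such `J`) rests on it.

## The functional and the statement

For a finite set `V`, a coupling `J` and a field `h : V → ℝ`,
`Z_J(h) = ∑_{σ∈{±1}^V} exp{-(β/2) 𝓔_J(σ+h, σ+h)}`, `𝓔_J(f,g) = ½∑_{x,y}J_{x,y}(f_x-f_y)(g_x-g_y)`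
(`wGradForm`, `wGaussZ`; for the adjacency matrix of a graph this is the tree's `gradForm`/`gaussZ`,
and `Z_J(0)` is `e^{-β∑_{{x,y}}J_{x,y}}` times the partition function of the Hamiltonian
`-∑_{{x,y}}J_{x,y}σ_xσ_y`, Panis's `H_{Λ,J,0}`). A *reflection* of `V` is an involution `θ : V ≃ V`
exchanging a "positive half" `P` with its complement; `J` is *reflection positive* for `(θ, P)` if it is
`θ`-invariant and the crossing kernel `K(x,y) = J_{x,θy}` (`x, y ∈ P`) is positive semidefinite
(Fröhlich–Israel–Lieb–Simon's criterion; Friedli–Velenik 2017, Lemma 10.8 for pair interactions;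
Biskup 2009, Lemma 5.4). PROVED here:

1. `exists_features_of_posSemidef` — a positive semidefinite symmetric kernel on a finite set
   factorises, `∑_{x,y}K_{x,y}u_xv_y = ∑_i (∑_x a_{i,x}u_x)(∑_y a_{i,y}v_y)` (Mathlib:
   `CStarAlgebra.nonneg_iff_eq_star_mul_self` for real matrices, `K = aᵀa`);
2. `wExponent_reflect_split`, `wGaussZ_eq_wPairSum` — the exponent splits along a reflection as
   `A_g(σ|_P) + A_{g∘θ}((σ∘θ)|_P) + β∑_{x,y∈P}J_{x,θy}(σ_x+g_x)(σ_{θy}+g_{θy})` with the half exponent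
   `A_g(τ) = -(β/2)[½∑_{x,y∈P}J_{x,y}(τ_x+g_x-τ_y-g_y)² + ∑_{x∈P}κ_x(τ_x+g_x)²]`, `κ_x = ∑_{y∈P}J_{x,θy}`
   (the long-range version of Friedli–Velenik's `A + Θ(B) + ∑C_αΘ(D_α)`), and `Z_J(g)` is the
   corresponding two-half sum `wPairSum(g, g∘θ)`;
3. `wPairSum_sq_le` — Lemma 10.28 for this kernel: by (1) the crossing term is `β∑_i p_i(τ)q_i(τ')`,
   so the tree's exponential-series Cauchy–Schwarz `expKernel_cauchySchwarz` applies; hence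
   **`wGaussZ_sq_le_reflect : Z_J(h)² ≤ Z_J(h⁺)Z_J(h⁻)`** for every reflection-positive `(θ, P)`;
4. **`wGaussZ_le_wGaussZ_zero`** — Gaussian domination `Z_J(h) ≤ Z_J(0)` on the torus `(ℤ/Lℤ)^d`,
   `L` even, `L ≥ 4`, `β ≥ 0`, for every symmetric `J` invariant under all reflections between
   sites `Θ_{i,k} : x_i ↦ 2k+1-x_i` with positive semidefinite crossing kernels: the descent of
   `GaussianDominationProofs.lean` on the number of bad NEAREST-NEIGHBOUR bonds of the field (its
   bookkeeping `badBonds_reflPlus_add_reflMinus` is pure torus geometry), a field without bad bonds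
   being constant on the torus (`eq_of_badBonds_torusGraph_eq_zero`) and `Z_J(h + c) = Z_J(h)`.

Not here: the infrared bound deduced from (4) for translation-invariant `J` (next file), and the
verification of the positive semidefiniteness for the periodised power-law couplings (Panis's
example (iii)), which is the analytic input of Panis's Proposition 3.4 for that family.

## References

* J. Fröhlich, R. Israel, E. H. Lieb, B. Simon, *Phase transitions and reflection positivity. I*,
  Comm. Math. Phys. 62 (1978) 1–34, §2–§3 (reflection positivity of long-range pair interactions;
  Gaussian domination) [FILS1978] (not held; cited through Panis 2023, §3.1 and Friedli–Velenik).
* S. Friedli, Y. Velenik, *Statistical Mechanics of Lattice Systems*, CUP (2017), §10.3 (reflections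
  through edges, (10.1)–(10.2)), Lemma 10.8 (reflection positivity of pair interactions), §10.5.3,
  Lemma 10.28, Prop. 10.27 and its proof (pp. 503–505) [FriedliVelenik2017] (held; pp. 499–507 read).
* R. Panis, arXiv:2309.05797 (2023) = Ann. Probab. 54 (2026), §3.1, Definition 3.1, examples (i)–(iv),
  Proposition 3.4 [Panis2023Triviality] (held; pp. 13–14 read).
* M. Biskup, *Reflection positivity and phase transitions in lattice spin models*, LNM 1970 (2009),
  §5 [Biskup2009].
-/

noncomputable section

open MeasureTheory Filter Topology Finset Complex
open scoped ComplexConjugate Real MatrixOrder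

namespace Literature.Probability.LatticeModels

/-! ### Positive semidefinite kernels on a finite set factorise through features -/

section PSD

variable {n : Type*} [Fintype n] [DecidableEq n]

/-- **A positive semidefinite symmetric real kernel factorises**: if `K` is symmetric with
`∑_{x,y}K_{x,y}u_xu_y ≥ 0` for all `u`, there are features `a_{i,x}` (`i ∈ n`) with
`∑_{x,y}K_{x,y}u_xv_y = ∑_i(∑_xa_{i,x}u_x)(∑_ya_{i,y}v_y)` for all `u, v` (`K = aᵀa`, from the
square root in the C⋆-algebra of real matrices). This is the finite-dimensional content of
"reflection positivity of pair interactions with a positive semidefinite crossing kernel"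
(Friedli–Velenik 2017, Lemma 10.8: "`-∑ J Θ` … is of the form `∑_α C_αΘ(C_α)`"). [cite: FriedliVelenik2017, Lemma 10.8] -/
theorem exists_features_of_posSemidef (K : n → n → ℝ) (hsymm : ∀ x y, K x y = K y x)
    (hpos : ∀ u : n → ℝ, 0 ≤ ∑ x, ∑ y, K x y * u x * u y) :
    ∃ a : n → n → ℝ, ∀ u v : n → ℝ,
      ∑ x, ∑ y, K x y * u x * v y = ∑ i, (∑ x, a i x * u x) * (∑ y, a i y * v y) := by
  set M : Matrix n n ℝ := Matrix.of fun x y => K x y with hMdef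
  have hH : M.IsHermitian := by
    rw [Matrix.IsHermitian, Matrix.conjTranspose_eq_transpose_of_trivial]
    ext x y
    simp [hMdef, hsymm]
  have hM : M.PosSemidef := by
    refine Matrix.PosSemidef.of_dotProduct_mulVec_nonneg hH fun u => ?_
    have : dotProduct (star u) (M.mulVec u) = ∑ x, ∑ y, K x y * u x * u y := by
      simp only [dotProduct, Matrix.mulVec, hMdef, Matrix.of_apply, star_trivial, Finset.mul_sum]
      refine Finset.sum_congr rfl fun x _ => Finset.sum_congr rfl fun y _ => by ring
    rw [this]; exact hpos u
  obtain ⟨a, ha⟩ := CStarAlgebra.nonneg_iff_eq_star_mul_self.mp hM.nonneg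
  rw [Matrix.star_eq_conjTranspose, Matrix.conjTranspose_eq_transpose_of_trivial] at ha
  refine ⟨fun i x => a i x, fun u v => ?_⟩
  have hK : ∀ x y, K x y = ∑ i, a i x * a i y := by
    intro x y
    have := congr_fun (congr_fun ha x) y
    simp only [hMdef, Matrix.of_apply, Matrix.mul_apply, Matrix.transpose_apply] at this
    exact this
  calc ∑ x, ∑ y, K x y * u x * v y
      = ∑ x, ∑ y, ∑ i, a i x * a i y * u x * v y := by
        refine Finset.sum_congr rfl fun x _ => Finset.sum_congr rfl fun y _ => ?_
        rw [hK, Finset.sum_mul, Finset.sum_mul]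
    _ = ∑ x, ∑ i, ∑ y, a i x * a i y * u x * v y := Finset.sum_congr rfl fun x _ => Finset.sum_comm
    _ = ∑ i, ∑ x, ∑ y, a i x * a i y * u x * v y := Finset.sum_comm
    _ = ∑ i, (∑ x, a i x * u x) * (∑ y, a i y * v y) := by
        refine Finset.sum_congr rfl fun i _ => ?_
        rw [Finset.sum_mul_sum]
        exact Finset.sum_congr rfl fun x _ => Finset.sum_congr rfl fun y _ => by ring

end PSD

/-! ### The weighted Dirichlet form and the functional `Z_J(h)` -/

section Weighted

variable {V : Type*} [Fintype V] [DecidableEq V] (J : V → V → ℝ)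

omit [DecidableEq V] in
/-- The Dirichlet form of a pair interaction, `𝓔_J(f,g) = ½ ∑_{x,y∈V} J_{x,y}(f_x - f_y)(g_x - g_y)`
(each unordered pair once for symmetric `J`; for the adjacency matrix of a graph this is the tree's
`gradForm`). [cite: FriedliVelenik2017, §10.5.3, eq. (10.47) (the quadratic form ∑_{{i,j}}(h_i-h_j)²)] -/
def wGradForm (f g : V → ℝ) : ℝ := (∑ x, ∑ y, J x y * ((f x - f y) * (g x - g y))) / 2

/-- **The functional `Z_J(h)` of Gaussian domination for a pair interaction** on Ising spins:
`Z_J(h) = ∑_{σ∈{±1}^V} exp{-(β/2) 𝓔_J(σ+h, σ+h)}` (Friedli–Velenik 2017, display before Prop. 10.27,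
with `ν = 1`, counting reference measure, `β/2` for their `β`, and the bond sum weighted by `J`;
`Z_J(0) = e^{-β∑_{{x,y}}J_{x,y}} ∑_σ e^{β∑_{{x,y}}J_{x,y}σ_xσ_y}`). [cite: FriedliVelenik2017, §10.5.3, display before Prop. 10.27] [cite: Panis2023Triviality, §1.2.1 (H_{Λ,J,h}) and Definition 3.1] -/
def wGaussZ (β : ℝ) (h : V → ℝ) : ℝ :=
  ∑ σ : V → ℤˣ, Real.exp (-(β / 2) * wGradForm J (fun x => spinAt x σ + h x) (fun x => spinAt x σ + h x))

variable {J}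

/-- `Z_J > 0`. [folklore] -/
theorem wGaussZ_pos (β : ℝ) (h : V → ℝ) : 0 < wGaussZ J β h :=
  Finset.sum_pos (fun _ _ => Real.exp_pos _) Finset.univ_nonempty

/-- A constant shift of the field does not change `Z_J`: `Z_J(h + c) = Z_J(h)`. [folklore] -/
theorem wGaussZ_add_const (β : ℝ) (h : V → ℝ) (c : ℝ) :
    wGaussZ J β (fun x => h x + c) = wGaussZ J β h := by
  unfold wGaussZ wGradForm
  refine Finset.sum_congr rfl fun σ _ => ?_
  congr 2
  congr 1
  exact Finset.sum_congr rfl fun x _ => Finset.sum_congr rfl fun y _ => by ring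

end Weighted

/-! ### Reflections: the half exponent, the two-half sum, and Lemma 10.28 for the crossing kernel -/

section Reflection

variable {V : Type*} [Fintype V] [DecidableEq V] (J : V → V → ℝ) (θ : V ≃ V) (P : Finset V)

/-- The half exponent of a pair interaction along a reflection:
`A_g(τ) = -(β/2)[½∑_{x,y∈P}J_{x,y}(τ_x+g_x-τ_y-g_y)² + ∑_{x∈P}κ_x(τ_x+g_x)²]`, `κ_x = ∑_{y∈P}J_{x,θy}`
(the energy inside the positive half plus the "self" part of the crossing energy; the long-range
version of the `A` of Friedli–Velenik 2017, proof of Prop. 10.27). [cite: FriedliVelenik2017, §10.5.3, proof of Prop. 10.27] -/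
def wHalfExponent (β : ℝ) (g : V → ℝ) (τ : V → ℤˣ) : ℝ :=
  -(β / 2) * ((∑ x ∈ P, ∑ y ∈ P, J x y * (spinAt x τ + g x - (spinAt y τ + g y)) ^ 2) / 2 +
    ∑ x ∈ P, (∑ y ∈ P, J x (θ y)) * (spinAt x τ + g x) ^ 2)

/-- The half weight `e^{A_g}` on configurations supported in `P` (spins off `P` frozen to `+1`), `0`
on the others. [cite: FriedliVelenik2017, §10.5.3, proof of Prop. 10.27] -/
def wHalfWeight (β : ℝ) (g : V → ℝ) (τ : V → ℤˣ) : ℝ :=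
  if ∀ x, x ∉ P → τ x = 1 then Real.exp (wHalfExponent J θ P β g τ) else 0

/-- The two-half sum `∑_{τ,τ'} e^{A_{g₁}(τ)}e^{A_{g₂}(τ')} e^{β∑_{x,y∈P}J_{x,θy}(τ_x+g₁(x))(τ'_y+g₂(y))}`
(Friedli–Velenik 2017, Lemma 10.28's `⟨e^{A+ΘB+∑C_αΘD_α}⟩` for the crossing kernel `J_{x,θy}`).
[cite: FriedliVelenik2017, Lemma 10.28 and proof of Prop. 10.27] -/
def wPairSum (β : ℝ) (g₁ g₂ : V → ℝ) : ℝ :=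
  ∑ τ : V → ℤˣ, ∑ τ' : V → ℤˣ, wHalfWeight J θ P β g₁ τ * wHalfWeight J θ P β g₂ τ' *
    Real.exp (β * ∑ x ∈ P, ∑ y ∈ P, J x (θ y) * ((spinAt x τ + g₁ x) * (spinAt y τ' + g₂ y)))

variable {J θ P}

omit [Fintype V] [DecidableEq V] in
/-- The half exponent depends on the field only through its values on `P`. [folklore] -/
theorem wHalfExponent_congr (β : ℝ) {g g' : V → ℝ} (hg : ∀ x ∈ P, g x = g' x) (τ : V → ℤˣ) :
    wHalfExponent J θ P β g τ = wHalfExponent J θ P β g' τ := by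
  unfold wHalfExponent
  congr 2
  · congr 1
    exact Finset.sum_congr rfl fun x hx => Finset.sum_congr rfl fun y hy => by rw [hg x hx, hg y hy]
  · exact Finset.sum_congr rfl fun x hx => by rw [hg x hx]

/-- `wPairSum` depends on the fields only through their values on `P`. [folklore] -/
theorem wPairSum_congr (β : ℝ) {g₁ g₁' g₂ g₂' : V → ℝ} (h₁ : ∀ x ∈ P, g₁ x = g₁' x)
    (h₂ : ∀ x ∈ P, g₂ x = g₂' x) :
    wPairSum J θ P β g₁ g₂ = wPairSum J θ P β g₁' g₂' := by
  unfold wPairSum wHalfWeight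
  refine Finset.sum_congr rfl fun τ _ => Finset.sum_congr rfl fun τ' _ => ?_
  rw [wHalfExponent_congr β h₁, wHalfExponent_congr β h₂,
    Finset.sum_congr rfl fun x hx => Finset.sum_congr rfl fun y hy => by rw [h₁ x hx, h₂ y hy]]

/-- **Lemma 10.28 for the crossing kernel of a reflection-positive pair interaction**:
`wPairSum(g₁,g₂)² ≤ wPairSum(g₁,g₁)·wPairSum(g₂,g₂)` for `β ≥ 0`, whenever the crossing kernel
`K(x,y) = J_{x,θy}` (`x,y ∈ P`) is symmetric and positive semidefinite — it then factorises through
features (`exists_features_of_posSemidef`), the crossing term becomes `β∑_ip_i(τ)q_i(τ')`, and the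
tree's `expKernel_cauchySchwarz` applies. [cite: FriedliVelenik2017, Lemma 10.28, with Lemma 10.8] -/
theorem wPairSum_sq_le {β : ℝ} (hβ : 0 ≤ β) (hKs : ∀ x ∈ P, ∀ y ∈ P, J x (θ y) = J y (θ x))
    (hK : ∀ u : V → ℝ, 0 ≤ ∑ x ∈ P, ∑ y ∈ P, J x (θ y) * u x * u y) (g₁ g₂ : V → ℝ) :
    wPairSum J θ P β g₁ g₂ ^ 2 ≤ wPairSum J θ P β g₁ g₁ * wPairSum J θ P β g₂ g₂ := by
  classical
  -- the kernel on the subtype `↥P`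
  set K : ↥P → ↥P → ℝ := fun x y => J x (θ y) with hKdef
  have hKs' : ∀ x y : ↥P, K x y = K y x := fun x y => hKs x x.2 y y.2
  have hK' : ∀ u : ↥P → ℝ, 0 ≤ ∑ x, ∑ y, K x y * u x * u y := by
    intro u
    set u' : V → ℝ := fun x => if hx : x ∈ P then u ⟨x, hx⟩ else 0 with hu'
    have h := hK u'
    have hcoe : ∑ x ∈ P, ∑ y ∈ P, J x (θ y) * u' x * u' y = ∑ x : ↥P, ∑ y : ↥P, K x y * u x * u y := by
      rw [← Finset.sum_coe_sort P]
      refine Finset.sum_congr rfl fun x _ => ?_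
      rw [← Finset.sum_coe_sort P]
      refine Finset.sum_congr rfl fun y _ => ?_
      simp [hu', hKdef, x.2, y.2]
    rwa [hcoe] at h
  obtain ⟨a, ha⟩ := exists_features_of_posSemidef K hKs' hK'
  -- the crossing term through features
  have hcross : ∀ (f₁ f₂ : V → ℝ) (τ τ' : V → ℤˣ),
      ∑ x ∈ P, ∑ y ∈ P, J x (θ y) * ((spinAt x τ + f₁ x) * (spinAt y τ' + f₂ y)) =
        ∑ i : ↥P, (∑ x : ↥P, a i x * (spinAt (x : V) τ + f₁ x)) * (∑ y : ↥P, a i y * (spinAt (y : V) τ' + f₂ y)) := by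
    intro f₁ f₂ τ τ'
    rw [← ha (fun x : ↥P => spinAt (x : V) τ + f₁ x) (fun y : ↥P => spinAt (y : V) τ' + f₂ y),
      ← Finset.sum_coe_sort P]
    refine Finset.sum_congr rfl fun x _ => ?_
    rw [← Finset.sum_coe_sort P]
    exact Finset.sum_congr rfl fun y _ => by simp only [hKdef]; ring
  have h := expKernel_cauchySchwarz (T := V → ℤˣ) (C := ↥P) hβ
    (wHalfWeight J θ P β g₁) (wHalfWeight J θ P β g₂)
    (fun i τ => ∑ x : ↥P, a i x * (spinAt (x : V) τ + g₁ x))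
    (fun i τ => ∑ x : ↥P, a i x * (spinAt (x : V) τ + g₂ x))
  unfold wPairSum
  simp only [hcross]
  exact h

end Reflection

/-! ### The reflection identity `Z_J(h) = wPairSum(h, h∘θ)` and `Z_J(h)² ≤ Z_J(h⁺)Z_J(h⁻)` -/

section ReflectionIdentity

variable {V : Type*} [Fintype V] [DecidableEq V] {J : V → V → ℝ} {θ : V ≃ V} {P : Finset V}

/-- A sum over `V` splits into the positive half and its mirror image: `∑_V f = ∑_P f + ∑_P f∘θ`
(for an involution `θ` exchanging `P` and its complement). [cite: FriedliVelenik2017, §10.3, eq. (10.2) (𝕋_L = 𝕋_{L,+} ∪ 𝕋_{L,-}, Θ(𝕋_{L,+}) = 𝕋_{L,-})] -/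
theorem sum_eq_sum_add_sum_reflect (hθ : ∀ x, θ (θ x) = x) (hP : ∀ x, x ∈ P ↔ θ x ∉ P)
    {M : Type*} [AddCommMonoid M] (f : V → M) :
    ∑ x, f x = ∑ x ∈ P, f x + ∑ x ∈ P, f (θ x) := by
  classical
  rw [← Finset.sum_add_sum_compl P f]
  congr 1
  symm
  refine Finset.sum_nbij' θ θ (fun x hx => Finset.mem_compl.2 ((hP x).1 hx))
    (fun x hx => mem_of_not_mem_reflect hθ hP (Finset.mem_compl.1 hx)) (fun x _ => hθ x) (fun x _ => hθ x)
    (fun x _ => rfl)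

omit [Fintype V] [DecidableEq V] in
/-- For a `θ`-invariant symmetric coupling, `J_{x,θy} = J_{y,θx}`. [folklore] -/
theorem coupling_reflect_comm (hθ : ∀ x, θ (θ x) = x) (hJθ : ∀ x y, J (θ x) (θ y) = J x y)
    (hJs : ∀ x y, J x y = J y x) (x y : V) : J x (θ y) = J y (θ x) := by
  rw [← hJθ x (θ y), hθ, hJs]

/-- **Splitting the pair energy along a reflection** (the long-range analogue of Friedli–Velenik's
decomposition `A + Θ(B) + ∑C_αΘ(D_α)`): for a `θ`-invariant symmetric `J`,
`∑_{x,y∈V}J_{x,y}(u_x-u_y)² = ∑_{P²}J(u_x-u_y)² + ∑_{P²}J(u_{θx}-u_{θy})²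
 + 2[∑_{x∈P}κ_xu_x² + ∑_{x∈P}κ_xu_{θx}² - 2∑_{x,y∈P}J_{x,θy}u_xu_{θy}]`, `κ_x = ∑_{y∈P}J_{x,θy}`.
[cite: FriedliVelenik2017, §10.5.3, proof of Prop. 10.27 (the expansion of ‖ω_i-ω_j+h_i-h_j‖² on crossing bonds)] -/
theorem sum_sum_sq_reflect_split (hθ : ∀ x, θ (θ x) = x) (hP : ∀ x, x ∈ P ↔ θ x ∉ P)
    (hJθ : ∀ x y, J (θ x) (θ y) = J x y) (hJs : ∀ x y, J x y = J y x) (u : V → ℝ) :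
    ∑ x, ∑ y, J x y * (u x - u y) ^ 2 =
      ∑ x ∈ P, ∑ y ∈ P, J x y * (u x - u y) ^ 2 + ∑ x ∈ P, ∑ y ∈ P, J x y * (u (θ x) - u (θ y)) ^ 2 +
        2 * (∑ x ∈ P, (∑ y ∈ P, J x (θ y)) * u x ^ 2 + ∑ x ∈ P, (∑ y ∈ P, J x (θ y)) * u (θ x) ^ 2 -
          2 * ∑ x ∈ P, ∑ y ∈ P, J x (θ y) * (u x * u (θ y))) := by
  have hc := coupling_reflect_comm hθ hJθ hJs
  -- split both sums
  have houter := sum_eq_sum_add_sum_reflect hθ hP (fun x => ∑ y, J x y * (u x - u y) ^ 2)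
  have hinner : ∀ x, ∑ y, J x y * (u x - u y) ^ 2 =
      ∑ y ∈ P, J x y * (u x - u y) ^ 2 + ∑ y ∈ P, J x (θ y) * (u x - u (θ y)) ^ 2 := fun x =>
    sum_eq_sum_add_sum_reflect hθ hP (fun y => J x y * (u x - u y) ^ 2)
  rw [houter]
  simp only [hinner, Finset.sum_add_distrib]
  -- the four blocks
  have hPP' : ∑ x ∈ P, ∑ y ∈ P, J (θ x) (θ y) * (u (θ x) - u (θ y)) ^ 2 =
      ∑ x ∈ P, ∑ y ∈ P, J x y * (u (θ x) - u (θ y)) ^ 2 :=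
    Finset.sum_congr rfl fun x _ => Finset.sum_congr rfl fun y _ => by rw [hJθ]
  have hmix : ∑ x ∈ P, ∑ y ∈ P, J (θ x) y * (u (θ x) - u y) ^ 2 =
      ∑ x ∈ P, ∑ y ∈ P, J x (θ y) * (u x - u (θ y)) ^ 2 := by
    rw [Finset.sum_comm]
    refine Finset.sum_congr rfl fun x _ => Finset.sum_congr rfl fun y _ => ?_
    rw [hJs (θ y) x]
    ring
  have hexp : ∑ x ∈ P, ∑ y ∈ P, J x (θ y) * (u x - u (θ y)) ^ 2 =
      ∑ x ∈ P, (∑ y ∈ P, J x (θ y)) * u x ^ 2 + ∑ x ∈ P, (∑ y ∈ P, J x (θ y)) * u (θ x) ^ 2 -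
        2 * ∑ x ∈ P, ∑ y ∈ P, J x (θ y) * (u x * u (θ y)) := by
    have h1 : ∑ x ∈ P, ∑ y ∈ P, J x (θ y) * (u x - u (θ y)) ^ 2 =
        ∑ x ∈ P, ∑ y ∈ P, J x (θ y) * u x ^ 2 + ∑ x ∈ P, ∑ y ∈ P, J x (θ y) * u (θ y) ^ 2 -
          2 * ∑ x ∈ P, ∑ y ∈ P, J x (θ y) * (u x * u (θ y)) := by
      rw [Finset.mul_sum, ← Finset.sum_add_distrib, ← Finset.sum_sub_distrib]
      refine Finset.sum_congr rfl fun x _ => ?_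
      rw [Finset.mul_sum, ← Finset.sum_add_distrib, ← Finset.sum_sub_distrib]
      exact Finset.sum_congr rfl fun y _ => by ring
    have h2 : ∑ x ∈ P, ∑ y ∈ P, J x (θ y) * u x ^ 2 = ∑ x ∈ P, (∑ y ∈ P, J x (θ y)) * u x ^ 2 :=
      Finset.sum_congr rfl fun x _ => by rw [Finset.sum_mul]
    have h3 : ∑ x ∈ P, ∑ y ∈ P, J x (θ y) * u (θ y) ^ 2 = ∑ x ∈ P, (∑ y ∈ P, J x (θ y)) * u (θ x) ^ 2 := by
      rw [Finset.sum_comm]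
      refine Finset.sum_congr rfl fun y _ => ?_
      rw [Finset.sum_mul]
      exact Finset.sum_congr rfl fun x _ => by rw [hc x y]
    rw [h1, h2, h3]
  rw [hPP', hmix, hexp]
  ring

omit [Fintype V] in
/-- The half exponent at a cut configuration, in terms of `u = σ + g`. [folklore] -/
theorem wHalfExponent_cutCfg (β : ℝ) (g : V → ℝ) (σ : V → ℤˣ) :
    wHalfExponent J θ P β g (cutCfg P σ) =
      -(β / 2) * ((∑ x ∈ P, ∑ y ∈ P, J x y * ((spinAt x σ + g x) - (spinAt y σ + g y)) ^ 2) / 2 +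
        ∑ x ∈ P, (∑ y ∈ P, J x (θ y)) * (spinAt x σ + g x) ^ 2) := by
  unfold wHalfExponent
  congr 2
  · congr 1
    exact Finset.sum_congr rfl fun x hx => Finset.sum_congr rfl fun y hy => by
      rw [spinAt_cutCfg_of_mem σ hx, spinAt_cutCfg_of_mem σ hy]
  · exact Finset.sum_congr rfl fun x hx => by rw [spinAt_cutCfg_of_mem σ hx]

omit [Fintype V] [DecidableEq V] in
/-- `spinAt x (σ ∘ θ) = spinAt (θ x) σ`. [folklore] -/
theorem spinAt_comp_reflect (σ : V → ℤˣ) (x : V) : spinAt x (σ ∘ θ) = spinAt (θ x) σ := rfl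

/-- **The exponent of `Z_J(h)` split along a reflection**:
`-(β/2)𝓔_J(σ+g,σ+g) = A_g(σ|_P) + A_{g∘θ}((σ∘θ)|_P) + β∑_{x,y∈P}J_{x,θy}(σ_x+g_x)(σ_{θy}+g_{θy})`.
[cite: FriedliVelenik2017, §10.5.3, proof of Prop. 10.27] -/
theorem wExponent_reflect_split (hθ : ∀ x, θ (θ x) = x) (hP : ∀ x, x ∈ P ↔ θ x ∉ P)
    (hJθ : ∀ x y, J (θ x) (θ y) = J x y) (hJs : ∀ x y, J x y = J y x) (β : ℝ) (g : V → ℝ)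
    (σ : V → ℤˣ) :
    -(β / 2) * wGradForm J (fun x => spinAt x σ + g x) (fun x => spinAt x σ + g x) =
      wHalfExponent J θ P β g (cutCfg P σ) +
        wHalfExponent J θ P β (g ∘ θ) (cutCfg P (σ ∘ θ)) +
          β * ∑ x ∈ P, ∑ y ∈ P, J x (θ y) *
            ((spinAt x (cutCfg P σ) + g x) * (spinAt y (cutCfg P (σ ∘ θ)) + (g ∘ θ) y)) := by
  set u : V → ℝ := fun x => spinAt x σ + g x with hu
  have hsq : wGradForm J (fun x => spinAt x σ + g x) (fun x => spinAt x σ + g x) =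
      (∑ x, ∑ y, J x y * (u x - u y) ^ 2) / 2 := by
    unfold wGradForm
    congr 1
    exact Finset.sum_congr rfl fun x _ => Finset.sum_congr rfl fun y _ => by simp only [hu]; ring
  have hA : wHalfExponent J θ P β g (cutCfg P σ) =
      -(β / 2) * ((∑ x ∈ P, ∑ y ∈ P, J x y * (u x - u y) ^ 2) / 2 +
        ∑ x ∈ P, (∑ y ∈ P, J x (θ y)) * u x ^ 2) := by
    rw [wHalfExponent_cutCfg]
  have hB : wHalfExponent J θ P β (g ∘ θ) (cutCfg P (σ ∘ θ)) =
      -(β / 2) * ((∑ x ∈ P, ∑ y ∈ P, J x y * (u (θ x) - u (θ y)) ^ 2) / 2 +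
        ∑ x ∈ P, (∑ y ∈ P, J x (θ y)) * u (θ x) ^ 2) := by
    rw [wHalfExponent_cutCfg]
    simp only [hu, spinAt_comp_reflect, Function.comp_apply]
  have hC : ∑ x ∈ P, ∑ y ∈ P, J x (θ y) *
      ((spinAt x (cutCfg P σ) + g x) * (spinAt y (cutCfg P (σ ∘ θ)) + (g ∘ θ) y)) =
        ∑ x ∈ P, ∑ y ∈ P, J x (θ y) * (u x * u (θ y)) := by
    refine Finset.sum_congr rfl fun x hx => Finset.sum_congr rfl fun y hy => ?_
    rw [spinAt_cutCfg_of_mem σ hx, spinAt_cutCfg_of_mem _ hy, spinAt_comp_reflect]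
    simp only [hu, Function.comp_apply]
  rw [hsq, hA, hB, hC, sum_sum_sq_reflect_split hθ hP hJθ hJs u]
  ring

/-- **`Z_J(h) = wPairSum(h, h∘θ)`**: the functional in the two-half form (`σ ↦ (σ|_P, (σ∘θ)|_P)` is a
bijection onto pairs of half configurations and the exponent splits as in `wExponent_reflect_split`).
[cite: FriedliVelenik2017, §10.5.3, proof of Prop. 10.27] -/
theorem wGaussZ_eq_wPairSum (hθ : ∀ x, θ (θ x) = x) (hP : ∀ x, x ∈ P ↔ θ x ∉ P)
    (hJθ : ∀ x y, J (θ x) (θ y) = J x y) (hJs : ∀ x y, J x y = J y x) (β : ℝ) (g : V → ℝ) :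
    wGaussZ J β g = wPairSum J θ P β g (g ∘ θ) := by
  classical
  unfold wGaussZ wPairSum
  rw [← Finset.sum_product']
  -- restrict to admissible pairs
  set F : (V → ℤˣ) × (V → ℤˣ) → ℝ := fun p => wHalfWeight J θ P β g p.1 *
    wHalfWeight J θ P β (g ∘ θ) p.2 *
      Real.exp (β * ∑ x ∈ P, ∑ y ∈ P, J x (θ y) * ((spinAt x p.1 + g x) * (spinAt y p.2 + (g ∘ θ) y)))
    with hF
  set Adm := ((Finset.univ : Finset (V → ℤˣ)) ×ˢ (Finset.univ : Finset (V → ℤˣ))).filter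
    (fun p => (∀ x, x ∉ P → p.1 x = 1) ∧ (∀ x, x ∉ P → p.2 x = 1)) with hAdm
  have hrestrict : ∑ p ∈ (Finset.univ : Finset (V → ℤˣ)) ×ˢ (Finset.univ : Finset (V → ℤˣ)), F p =
      ∑ p ∈ Adm, F p := by
    rw [hAdm, Finset.sum_filter_of_ne]
    intro p _ hp
    by_contra hcon
    apply hp
    simp only [hF, wHalfWeight]
    rcases not_and_or.1 hcon with h1 | h2
    · rw [if_neg h1]; ring
    · rw [if_neg h2]; ring
  show ∑ σ, Real.exp (-(β / 2) * wGradForm J (fun x => spinAt x σ + g x) fun x => spinAt x σ + g x) =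
    ∑ p ∈ (Finset.univ : Finset (V → ℤˣ)) ×ˢ (Finset.univ : Finset (V → ℤˣ)), F p
  rw [hrestrict]
  symm
  refine Finset.sum_nbij' (mergeCfg θ P) (fun σ => (cutCfg P σ, cutCfg P (σ ∘ θ)))
    (fun p _ => Finset.mem_univ _) (fun σ _ => ?_) (fun p hp => ?_) (fun σ _ => ?_) (fun p hp => ?_)
  · -- the split of a configuration is admissible
    rw [hAdm, Finset.mem_filter]
    exact ⟨Finset.mem_product.2 ⟨Finset.mem_univ _, Finset.mem_univ _⟩,
      fun x hx => cutCfg_of_not_mem _ hx, fun x hx => cutCfg_of_not_mem _ hx⟩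
  · -- split ∘ merge = id on admissible pairs
    obtain ⟨-, h1, h2⟩ := Finset.mem_filter.1 hp
    refine Prod.ext (funext fun x => ?_) (funext fun x => ?_)
    · by_cases hx : x ∈ P
      · simp [cutCfg, mergeCfg, hx]
      · simp [cutCfg, hx, h1 x hx]
    · by_cases hx : x ∈ P
      · have hθx : θ x ∉ P := (hP x).1 hx
        simp [cutCfg, mergeCfg, hx, hθx, hθ]
      · simp [cutCfg, hx, h2 x hx]
  · -- merge ∘ split = id
    funext x
    by_cases hx : x ∈ P
    · simp [mergeCfg, cutCfg, hx]
    · have hθx : θ x ∈ P := mem_of_not_mem_reflect hθ hP hx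
      simp [mergeCfg, cutCfg, hx, hθx, hθ]
  · -- the summands agree
    obtain ⟨-, h1, h2⟩ := Finset.mem_filter.1 hp
    set σ := mergeCfg θ P p with hσ
    have hp1 : cutCfg P σ = p.1 := by
      funext x
      by_cases hx : x ∈ P
      · simp [cutCfg, hσ, mergeCfg, hx]
      · simp [cutCfg, hx, h1 x hx]
    have hp2 : cutCfg P (σ ∘ θ) = p.2 := by
      funext x
      by_cases hx : x ∈ P
      · have hθx : θ x ∉ P := (hP x).1 hx
        simp [cutCfg, hσ, mergeCfg, hx, hθx, hθ]
      · simp [cutCfg, hx, h2 x hx]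
    simp only [hF, wHalfWeight, if_pos h1, if_pos h2]
    rw [← Real.exp_add, ← Real.exp_add, wExponent_reflect_split hθ hP hJθ hJs β g σ, hp1, hp2]

/-- **`Z_J(h)² ≤ Z_J(h⁺) Z_J(h⁻)` for a reflection-positive pair interaction** (Friedli–Velenik 2017,
proof of Prop. 10.27 with Lemma 10.8/10.28): `θ` an involution exchanging `P` and its complement, `J`
symmetric and `θ`-invariant with positive semidefinite crossing kernel `J_{x,θy}` (`x, y ∈ P`), `β ≥ 0`.
[cite: FriedliVelenik2017, §10.5.3, proof of Prop. 10.27, with Lemma 10.8] -/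
theorem wGaussZ_sq_le_reflect (hθ : ∀ x, θ (θ x) = x) (hP : ∀ x, x ∈ P ↔ θ x ∉ P)
    (hJθ : ∀ x y, J (θ x) (θ y) = J x y) (hJs : ∀ x y, J x y = J y x)
    (hK : ∀ u : V → ℝ, 0 ≤ ∑ x ∈ P, ∑ y ∈ P, J x (θ y) * u x * u y) {β : ℝ} (hβ : 0 ≤ β) (h : V → ℝ) :
    wGaussZ J β h ^ 2 ≤ wGaussZ J β (reflPlus θ P h) * wGaussZ J β (reflMinus θ P h) := by
  rw [wGaussZ_eq_wPairSum hθ hP hJθ hJs β h, wGaussZ_eq_wPairSum hθ hP hJθ hJs β (reflPlus θ P h),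
    wGaussZ_eq_wPairSum hθ hP hJθ hJs β (reflMinus θ P h)]
  have hplus : wPairSum J θ P β (reflPlus θ P h) (reflPlus θ P h ∘ θ) = wPairSum J θ P β h h := by
    refine wPairSum_congr β (fun x hx => by simp [reflPlus, hx]) (fun x hx => ?_)
    have hθx : θ x ∉ P := (hP x).1 hx
    simp [reflPlus, hθx, hθ]
  have hminus : wPairSum J θ P β (reflMinus θ P h) (reflMinus θ P h ∘ θ) =
      wPairSum J θ P β (h ∘ θ) (h ∘ θ) := by
    refine wPairSum_congr β (fun x hx => by simp [reflMinus, hx]) (fun x hx => ?_)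
    have hθx : θ x ∉ P := (hP x).1 hx
    simp [reflMinus, hθx]
  rw [hplus, hminus]
  have hKs : ∀ x ∈ P, ∀ y ∈ P, J x (θ y) = J y (θ x) := fun x _ y _ => coupling_reflect_comm hθ hJθ hJs x y
  exact wPairSum_sq_le hβ hKs hK h (h ∘ θ)

end ReflectionIdentity

/-! ### Gaussian domination on the even torus by descent on the number of bad nearest-neighbour bonds -/

section TorusDescent

variable {d L : ℕ} [NeZero L]

/-- A field whose value is unchanged across every nearest-neighbour bond of the torus is constant
(`(ℤ/Lℤ)^d` is generated by the unit vectors). [folklore] -/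
theorem eq_of_forall_add_single_eq {g : TorusSite d L → ℝ}
    (h : ∀ (x : TorusSite d L) (i : Fin d), g (x + Pi.single i 1) = g x) (x y : TorusSite d L) :
    g y = g x := by
  classical
  -- one direction, natural multiples
  have hnat : ∀ (i : Fin d) (n : ℕ) (z : TorusSite d L), g (z + Pi.single i (n : ZMod L)) = g z := by
    intro i n
    induction n with
    | zero => intro z; simp
    | succ n ih =>
      intro z
      rw [Nat.cast_succ, Pi.single_add, ← add_assoc, h, ih]
  have hone : ∀ (i : Fin d) (c : ZMod L) (z : TorusSite d L), g (z + Pi.single i c) = g z := by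
    intro i c z
    rw [← ZMod.natCast_zmod_val c]
    exact hnat i c.val z
  -- all directions
  have hall : ∀ (s : Finset (Fin d)) (v z : TorusSite d L), g (z + ∑ i ∈ s, Pi.single i (v i)) = g z := by
    intro s v
    induction s using Finset.induction_on with
    | empty => intro z; simp
    | insert j s hj ih =>
      intro z
      rw [Finset.sum_insert hj, add_comm (Pi.single j (v j) : TorusSite d L), ← add_assoc, hone, ih]
  have := hall Finset.univ (y - x) x
  rwa [Finset.univ_sum_single, add_sub_cancel] at this

/-- **A field without bad bonds is constant on the torus** (`L ≥ 2`): `N(g) = 0` forces `g_x = g_{x+eᵢ}`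
across every bond. [cite: FriedliVelenik2017, §10.5.3, proof of Prop. 10.27 ("If N(h*) = 0, then h*_i = h*_j for all {i,j}")] -/
theorem eq_of_badBonds_torusGraph_eq_zero (hL2 : 2 ≤ L) {g : TorusSite d L → ℝ}
    (hN : badBonds (torusGraph d L) g = 0) (x y : TorusSite d L) : g y = g x := by
  classical
  refine eq_of_forall_add_single_eq (fun z i => ?_) x y
  have hmem : s(z, z + Pi.single i 1) ∈ (torusGraph d L).edgeFinset :=
    SimpleGraph.mem_edgeFinset.2 ((SimpleGraph.mem_edgeSet _).2 (torusGraph_adj_add_single hL2 z i))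
  have hterm := (Finset.sum_eq_zero_iff.1 hN) _ hmem
  rw [badInd_mk] at hterm
  by_contra hne
  rw [if_neg (Ne.symm hne)] at hterm
  exact one_ne_zero hterm

/-- **Gaussian domination for reflection-positive pair interactions on the even torus**
(Fröhlich–Israel–Lieb–Simon; Friedli–Velenik 2017, Prop. 10.27 beyond nearest neighbours): for `L` even,
`L ≥ 4`, `β ≥ 0`, and a symmetric coupling `J` on `(ℤ/Lℤ)^d` that is invariant under every reflection
between sites `Θ_{i,k}` and whose crossing kernels `J_{x,Θ_{i,k}y}` on the positive half-tori are positive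
semidefinite, `Z_J(h) ≤ Z_J(0)` for every real field `h`. Proof: the descent of the nearest-neighbour
case (`GaussianDominationProofs.gaussZ_le_gaussZ_zero`) verbatim — maximise `Z_J` over the finite set of
fields with values in the range of `h`, take a maximiser with the fewest bad nearest-neighbour bonds, and
reflect through the mirror bisecting a bad bond (`wGaussZ_sq_le_reflect`, `badBonds_reflPlus_add_reflMinus`);
a maximiser without bad bonds is constant, and `Z_J(c) = Z_J(0)`.
[cite: FriedliVelenik2017, Prop. 10.27, eq. (10.43), with Lemma 10.8] [cite: Panis2023Triviality, Definition 3.1 and Proposition 3.4 (reflection-positive J on 𝕋_L)] -/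
theorem wGaussZ_le_wGaussZ_zero (hL : Even L) (hL4 : 4 ≤ L) {β : ℝ} (hβ : 0 ≤ β)
    {J : TorusSite d L → TorusSite d L → ℝ} (hJs : ∀ x y, J x y = J y x)
    (hJθ : ∀ (i : Fin d) (k : ZMod L) (x y : TorusSite d L),
      J (Torus.reflectBetweenSites i k x) (Torus.reflectBetweenSites i k y) = J x y)
    (hK : ∀ (i : Fin d) (k : ZMod L) (u : TorusSite d L → ℝ),
      0 ≤ ∑ x ∈ (Torus.halfBetweenSites i k).toFinset, ∑ y ∈ (Torus.halfBetweenSites i k).toFinset,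
        J x (Torus.reflectBetweenSites i k y) * u x * u y)
    (h : TorusSite d L → ℝ) :
    wGaussZ J β h ≤ wGaussZ J β 0 := by
  classical
  set Gr := torusGraph d L
  -- the finite set of fields with values in the range of `h`
  set R : Finset ℝ := Finset.univ.image h with hR
  set F : Finset (TorusSite d L → ℝ) := Fintype.piFinset fun _ => R with hF
  have hhF : h ∈ F := by
    rw [hF, Fintype.mem_piFinset]
    intro x
    exact Finset.mem_image_of_mem h (Finset.mem_univ x)
  have hFne : F.Nonempty := ⟨h, hhF⟩
  -- a maximiser of `Z_J` on `F`
  obtain ⟨g₀, hg₀F, hg₀max⟩ := Finset.exists_max_image F (wGaussZ J β) hFne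
  set Fmax := F.filter fun g => wGaussZ J β g = wGaussZ J β g₀ with hFmax
  have hFmaxne : Fmax.Nonempty := ⟨g₀, by simp [hFmax, hg₀F]⟩
  -- among the maximisers, one with the fewest bad bonds
  obtain ⟨g, hgFmax, hgmin⟩ := Finset.exists_min_image Fmax (badBonds Gr) hFmaxne
  obtain ⟨hgF, hgZ⟩ := Finset.mem_filter.1 hgFmax
  have hgmax : ∀ g' ∈ F, wGaussZ J β g' ≤ wGaussZ J β g := fun g' hg' => hgZ ▸ hg₀max g' hg'
  -- claim: `g` has no bad bond
  have hN : badBonds Gr g = 0 := by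
    by_contra hN0
    -- a bad bond `{x, x + eᵢ}`
    obtain ⟨e, he, hbad⟩ : ∃ e ∈ Gr.edgeFinset, badInd g e ≠ 0 := by
      by_contra hall
      push Not at hall
      exact hN0 (Finset.sum_eq_zero hall)
    obtain ⟨x, i, hxy⟩ : ∃ (x : TorusSite d L) (i : Fin d), e = s(x, x + Pi.single i 1) := by
      induction e using Sym2.ind with
      | _ a b =>
        have hab : Gr.Adj a b := (SimpleGraph.mem_edgeFinset.1 he)
        rw [torusGraph_adj_iff] at hab
        rcases hab.2 with ⟨i, rfl⟩ | ⟨i, rfl⟩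
        · exact ⟨a, i, rfl⟩
        · exact ⟨b, i, Sym2.eq_swap⟩
    subst hxy
    rw [badInd_mk] at hbad
    have hgx : g x ≠ g (x + Pi.single i 1) := by
      intro h'; rw [if_pos h'] at hbad; exact hbad rfl
    -- the reflection bisecting this bond
    set θ := Torus.reflectBetweenSites (d := d) (L := L) i (x i) with hθdef
    set P := (Torus.halfBetweenSites (d := d) (L := L) i (x i)).toFinset with hPdef
    have hθθ : ∀ z, θ (θ z) = z := Torus.reflectBetweenSites_involutive i (x i)
    have hadj : ∀ a b, Gr.Adj (θ a) (θ b) ↔ Gr.Adj a b :=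
      Torus.torusGraph_adj_reflectBetweenSites_iff i (x i)
    have hP : ∀ a, a ∈ P ↔ θ a ∉ P :=
      Torus.mem_halfBetweenSites_iff_reflect_not_mem hL i (x i)
    have hcross : ∀ a b, a ∈ P → b ∉ P → Gr.Adj a b → b = θ a := fun a b ha hb hab =>
      Torus.eq_reflectBetweenSites_of_adj hL hL4 i (x i) ha hb hab
    obtain ⟨hyP, hθy⟩ := Torus.add_single_mem_halfBetweenSites (by omega : 2 ≤ L) i x
    -- `Z(g)² ≤ Z(g⁺) Z(g⁻)` and both are at most `Z(g)`, so both equal `Z(g)`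
    have hsq := wGaussZ_sq_le_reflect (J := J) hθθ hP (hJθ i (x i)) hJs (hK i (x i)) hβ g
    have hPF : reflPlus θ P g ∈ F := reflPlus_mem_piFinset hgF
    have hMF : reflMinus θ P g ∈ F := reflMinus_mem_piFinset hgF
    have hPle := hgmax _ hPF
    have hMle := hgmax _ hMF
    have hZpos := wGaussZ_pos (J := J) β g
    have hPpos := wGaussZ_pos (J := J) β (reflPlus θ P g)
    have hMpos := wGaussZ_pos (J := J) β (reflMinus θ P g)
    have hPeq : wGaussZ J β (reflPlus θ P g) = wGaussZ J β g := by
      refine le_antisymm hPle ?_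
      by_contra hlt
      push Not at hlt
      have : wGaussZ J β (reflPlus θ P g) * wGaussZ J β (reflMinus θ P g) <
          wGaussZ J β g * wGaussZ J β g :=
        mul_lt_mul hlt hMle hMpos hZpos.le
      nlinarith
    have hMeq : wGaussZ J β (reflMinus θ P g) = wGaussZ J β g := by
      refine le_antisymm hMle ?_
      by_contra hlt
      push Not at hlt
      have : wGaussZ J β (reflPlus θ P g) * wGaussZ J β (reflMinus θ P g) <
          wGaussZ J β g * wGaussZ J β g :=
        mul_lt_mul' hPle hlt hMpos.le hZpos
      nlinarith
    -- so `g⁺, g⁻` are maximisers, and minimality of `N(g)` gives `N(g) ≤ N(g±)`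
    have hPmin : badBonds Gr g ≤ badBonds Gr (reflPlus θ P g) :=
      hgmin _ (Finset.mem_filter.2 ⟨hPF, hPeq.trans hgZ⟩)
    have hMmin : badBonds Gr g ≤ badBonds Gr (reflMinus θ P g) :=
      hgmin _ (Finset.mem_filter.2 ⟨hMF, hMeq.trans hgZ⟩)
    -- but the bisected bad bond is a crossing bond: `N(g⁺) + N(g⁻) ≤ 2N(g) - 2`
    have hcount := badBonds_reflPlus_add_reflMinus (G := Gr) hθθ hadj hP hcross g
    have hycross : x + Pi.single i 1 ∈ crossSites Gr θ P := by
      refine Finset.mem_filter.2 ⟨hyP, ?_⟩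
      rw [hθy]
      exact (torusGraph_adj_add_single (by omega) x i).symm
    have hone : (1 : ℕ) ≤ ∑ z ∈ crossSites Gr θ P, badInd g s(z, θ z) := by
      calc (1 : ℕ) = badInd g s(x + Pi.single i 1, θ (x + Pi.single i 1)) := by
            rw [badInd_mk, hθy, if_neg (Ne.symm hgx)]
        _ ≤ ∑ z ∈ crossSites Gr θ P, badInd g s(z, θ z) :=
          Finset.single_le_sum (f := fun z => badInd g s(z, θ z)) (fun z _ => Nat.zero_le _) hycross
    omega
  -- a field without bad bonds is constant, and `Z_J(c) = Z_J(0)`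
  have hconst : ∀ y, g y = g 0 := fun y => eq_of_badBonds_torusGraph_eq_zero (by omega) hN 0 y
  have hg : g = fun x => (0 : TorusSite d L → ℝ) x + g 0 := by
    funext y
    rw [Pi.zero_apply, zero_add]
    exact hconst y
  calc wGaussZ J β h ≤ wGaussZ J β g := hgmax h hhF
    _ = wGaussZ J β (fun x => (0 : TorusSite d L → ℝ) x + g 0) := congrArg (wGaussZ J β) hg
    _ = wGaussZ J β 0 := wGaussZ_add_const β 0 (g 0)

end TorusDescent

end Literature.Probability.LatticeModels

end
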